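import Summits.BirchSwinnertonDyer.BirchSwinnertonDyer.Theorems.KimAtThreeD7uTamagawaFreePlaces
import HarnessLib

/-!
# The TAMAGAWA-FREE bad places, II: at a finite `w ∤ p` with `p ∤ c_w = [E(ℚ_w) : E₀(ℚ_w)]`,
# [MR04]'s unramified structure `𝓕_u(w) = π_{k+1,*} H¹_ur(ℚ_w, T_pE)` EQUALS the canonical structure
# `𝓕_can(w) = π_{k+1,*} H¹(ℚ_w, T_pE)` on `E[p^{k+1}]` (both `= H¹_ur(ℚ_w, E[p^{k+1}])`), every `k`;
# hence `𝓕_u = 𝓕_can` at every finite place of a curve with `p ∤ c_ℓ` for all bad `ℓ ≠ p`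
# (cell `bsd-addord`, seat w2-tamdiv gen 3; route W2 `KimAtThreeKolyvagin`, items 19562 / 19560, «TamDiv∞»)

HONEST FRAMING: TOOL theorems (no definition, no named fact, no `sorry`); closes nothing by itself;
nothing is booked; BSD is not proved by any of this.  The exponent-`0` case of the Kolyvagin-system
Tamagawa factor `[𝓕_can(w) : 𝓕_u(w)] = (c_w)_p` (Rubin, *Euler Systems*, Lemma 1.3.5; Büyükboduk,
JNT 129 (2009) §2.1.2 Remark 2, hypothesis H.T of §3), in the tree's currency `localTamagawaNumber`:
where `p ∤ c_w`, [MR04] Remark A.5 (gen 2's `exists_isKolyvaginSystem_pair_blochKatoSelmerStructure_of_unramified_odd`)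
costs nothing — a Kolyvagin system for `𝓕_u` IS one for `𝓕_can` place by place; the Tamagawa defect of
an Euler system of `T_pE` lives at the places with `p ∣ c_w` only (the «`3 ∤ ∏ c_ℓ` ⟹ outright» pattern
of the W2 off-stratum items 19562 / 19599, at Kolyvagin-system level).

## What (`K = ℚ`; `c_w = (W.baseChange ℚ_w).localTamagawaNumber 𝓞_w`)

* §1 at a finite `w ∤ p` with `p ∤ c_w`, every `k`, every choice `L` above `p`:
  `unramifiedSubgroup_le_blochKatoSelmerStructure_inr_of_not_dvd_localTamagawaNumber`
  (`H¹_ur(ℚ_w, E[p^k · p]) ≤ 𝓕_u(w)`: an unramified class is principal on `I_w`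
  (`LocBridge.mem_unramifiedSubgroup_one_iff_exists`), subtract the coboundary, apply part I's lift);
  `propagatedSelmerStructure_inr_eq_unramifiedSubgroup_of_not_dvd_localTamagawaNumber`
  (`𝓕_can(w) = H¹_ur(ℚ_w, E[p^k · p])`: n1011 `propagatedSelmerStructure_inr_eq_kummerSelmerStructure` +
  row T-URTAM `kummerSelmerStructure_inr_eq_unramifiedSubgroup_of_not_dvd_localTamagawaNumber`, ANY
  reduction type); **`blochKatoSelmerStructure_inr_eq_propagatedSelmerStructure_of_not_dvd_localTamagawaNumber`**
  (`𝓕_u(w) = 𝓕_can(w)`; `≤` is gen 2's `blochKatoSelmerStructure_inr_le_propagatedSelmerStructure`) and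
  `blochKatoSelmerStructure_inr_eq_unramifiedSubgroup_of_not_dvd_localTamagawaNumber`.
* §2 (global): if `p ∤ c_ℓ` at every BAD `ℓ ≠ p`, then at EVERY finite place `w`
  `blochKatoSelmerStructure p (tateTorsionDatum W p k) ⊤ (Sum.inr w) = propagatedSelmerStructure W p k (Sum.inr w)`
  (`…_relaxed_inr_eq_…_of_forall_not_dvd_localTamagawaNumber`; at `w ∣ p` gen 2's
  `blochKatoSelmerStructure_relaxed_inr_eq_propagatedSelmerStructure`, at good `w ∤ p` `c_w = 1` by
  `not_dvd_localTamagawaNumber_of_hasGoodReductionAt`), and for any `L` at every finite `w ∤ p`.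
* §3 (odd `p`): at an archimedean place `H¹(ℝ, E[p^k · p]) = 0` (n1011
  `Derivative.Rat.localization_inl_eq_zero_of_odd`), so for odd `p` and `p ∤ c_ℓ` at every bad `ℓ ≠ p`
  **`blochKatoSelmerStructure p (tateTorsionDatum W p k) ⊤ = propagatedSelmerStructure W p k` as Selmer
  structures** (`…_relaxed_eq_…_of_odd_of_forall_not_dvd_localTamagawaNumber`), whence equal Selmer groups
  (`selmerGroup_blochKatoSelmerStructure_eq_…`) and equal modules of Kolyvagin systems for every
  Kolyvagin datum (`kolyvaginSystems_blochKatoSelmerStructure_eq_…`): `KS(𝓕_u) = KS(𝓕_can)`.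

HONEST LIMITS: the positive-exponent index (`p ∣ c_w`) is NOT here; no Euler system is asserted; no
Selmer bound; `p = 2` is excluded from §3 only through the archimedean place.  References:
K. Rubin, *Euler Systems* (2000) Lemma 1.3.5; B. Mazur, K. Rubin, Mem. AMS 799 (2004) Prop. 6.2.6,
App. A Remark A.5; K. Büyükboduk, JNT 129 (2009) §2.1.2 Remark 2, §3, Thm. 3.1; E. Schaefer, M. Stoll,
Trans. AMS 356 (2004) Lemma 3.1 / Prop. 3.2; J. S. Milne, *ADT* I Prop. 3.8 and Remark 3.10.
-/

noncomputable section

-- the cell's Theorems namespace `Summit.BirchSwinnertonDyer.BirchSwinnertonDyer.…` repeats the summit name by design (D-0017)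
set_option linter.dupNamespace false

open CategoryTheory Function Field IsDedekindDomain NumberField
open scoped NumberField Classical
open Literature.NumberTheory.GaloisRepresentations Literature.NumberTheory.EllipticCurves
open Literature.NumberTheory.GaloisRepresentations.DiscreteGaloisModule (unramifiedSubgroup)
open Literature.NumberTheory.GaloisRepresentations.IsNonarchimedeanLocalField
open WeierstrassCurve
open Literature.NumberTheory.GaloisCohomology
open Summit.BirchSwinnertonDyer.Rank1Residual.GaloisImage
open Summit.BirchSwinnertonDyer.Rank1Residual.GaloisImage.InertiaDivisible
open Summit.BirchSwinnertonDyer.Rank1Residual.GaloisImage.Derivative.Transverse.Rat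
open Summit.BirchSwinnertonDyer.Rank1Residual.X11b
open Summit.BirchSwinnertonDyer.BirchSwinnertonDyer.Theorems.KimAtThreeD7uUnramifiedMembership
open Summit.BirchSwinnertonDyer.BirchSwinnertonDyer.Theorems.KimAtThreeD7uBlochKatoCondition
open Summit.BirchSwinnertonDyer.BirchSwinnertonDyer.Theorems.KimAtThreeD7uKolyvaginPairBlochKato

namespace Summit.BirchSwinnertonDyer.BirchSwinnertonDyer.Theorems.KimAtThreeD7uTamagawaFreeStructures

open Summit.BirchSwinnertonDyer.BirchSwinnertonDyer.Theorems.KimAtThreeD7uTamagawaFreePlaces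

/-! ### §1 `𝓕_u(w) = 𝓕_can(w) = H¹_ur(ℚ_w, E[p^{k+1}])` at a Tamagawa-free place `w ∤ p` of `ℚ` -/

section Structures

variable (W : WeierstrassCurve ℚ) [W.IsElliptic] (p : ℕ) [hp : Fact p.Prime] (k : ℕ)
  (w : HeightOneSpectrum (𝓞 ℚ))

/-- Local notation: `E[p^k · p]|_{Γ_{ℚ_w}}` (= `(W.torsionGaloisModule (p^k · p)).toLocal (Sum.inr w)`). -/
local notation3 "𝕄" => (GaloisRep.restrictField (HeightOneSpectrum.adicCompletion ℚ w)
  (W.torsionGaloisModule ((p : ℤ) ^ k * (p : ℤ))))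

/-- **`H¹_ur(ℚ_w, E[p^k · p]) ≤ 𝓕_u(w)` at a Tamagawa-free `w ∤ p`**: at a finite place `w ∤ p` with
`p ∤ c_w`, every unramified class of `E[p^k · p]` lies in the Bloch–Kato condition
`blochKatoSelmerStructure p (tateTorsionDatum W p k) L (Sum.inr w) = π_{k+1,*} H¹_ur(ℚ_w, T_pE)`
([MR04]'s `𝓕_u(w)`), for every `L` (an unramified class is principal on `I_w`,
`LocBridge.mem_unramifiedSubgroup_one_iff_exists`; subtract the coboundary and apply part I's lift
`exists_unramified_tateLocalMap_eq_of_vanishing_inertia_of_not_dvd_localTamagawaNumber`).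
The good case (`c_w = 1`) is gen 2's `unramifiedSubgroup_le_blochKatoSelmerStructure_inr_of_hasGoodReductionAt`.
[cite: MazurRubin2004, App. A Remark A.5 (p. 81)] [cite: Rubin2000, Lemma 1.3.5]
[cite: MilneADT2006, Ch. I Prop. 3.8 and Remark 3.10] -/
theorem unramifiedSubgroup_le_blochKatoSelmerStructure_inr_of_not_dvd_localTamagawaNumber
    (L : (tateTorsionDatum W p k).LocalConditionsAbove p) (hw : ((p : ℕ) : 𝓞 ℚ) ∉ w.asIdeal)
    (hc : ¬ p ∣ (W.baseChange (w.adicCompletion ℚ)).localTamagawaNumber (w.adicCompletionIntegers ℚ)) :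
    unramifiedSubgroup (GaloisRep.toLocal w (W.torsionGaloisModule ((p : ℤ) ^ k * (p : ℤ)))) 1 ≤
      blochKatoSelmerStructure p (tateTorsionDatum W p k) L (Sum.inr w) := by
  intro x hx
  set F := w.adicCompletion ℚ with hFdef
  obtain ⟨φ₀, rfl⟩ := oneCocycleClass_surjective (DiscreteGaloisModule.toTopRep 𝕄) x
  obtain ⟨v, hv⟩ := (LocBridge.mem_unramifiedSubgroup_one_iff_exists (𝕄) φ₀).mp hx
  have hvc : Continuous fun g : absoluteGaloisGroup F => (DiscreteGaloisModule.toTopRep 𝕄).ρ g v :=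
    (𝕄).continuous_apply_left v
  let δ : contOneCocycles (DiscreteGaloisModule.toTopRep 𝕄) := principalCocycle _ v hvc
  let ψ : contOneCocycles (DiscreteGaloisModule.toTopRep 𝕄) := φ₀ - δ
  have hψI : ∀ n : absInertia F, ψ.1 n = 0 := fun n => by
    change (φ₀.1 - δ.1) n = 0
    rw [ContinuousMap.sub_apply, principalCocycle_apply, hv n n.2, sub_eq_zero]
    exact Subtype.ext (by
      rw [AddSubgroupClass.coe_sub, AddSubgroupClass.coe_sub, coe_restrictField_torsion_apply,
        coe_toTopRep_torsion_ρ_apply])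
  have hcl : oneCocycleClass (DiscreteGaloisModule.toTopRep 𝕄) φ₀ = oneCocycleClass _ ψ := by
    change _ = oneCocycleClass _ (φ₀ - δ)
    rw [oneCocycleClass_sub, oneCocycleClass_principalCocycle, sub_zero]
  refine mem_blochKatoSelmerStructure_of_exists_tateLocalMap_eq W p k w L hw ?_
  obtain ⟨y, hyI, hy⟩ :=
    exists_unramified_tateLocalMap_eq_of_vanishing_inertia_of_not_dvd_localTamagawaNumber W p k w hw hc ψ hψI
  exact ⟨y, hyI, hy.trans hcl.symm⟩

/-- **`𝓕_can(w) = H¹_ur(ℚ_w, E[p^k · p])` at a Tamagawa-free `w ∤ p`** (ANY reduction type): Mazur–Rubin's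
propagated canonical condition `im(H¹(ℚ_w, T_pE) → H¹(ℚ_w, E[p^k · p]))` IS the unramified condition at a
finite `w ∤ p` with `p ∤ c_w` — n1011's `propagatedSelmerStructure_inr_eq_kummerSelmerStructure`
(`𝓕_can(w) = 𝓛_w`, every finite `w ∤ p`) followed by row T-URTAM's
`kummerSelmerStructure_inr_eq_unramifiedSubgroup_of_not_dvd_localTamagawaNumber` (`𝓛_w = H¹_ur` at a
Tamagawa-free place; Schaefer–Stoll Lemma 3.1 / Prop. 3.2, Milne I.3.8) transported along
`((p ^ (k+1) : ℕ) : ℤ) = p^k · p`.  The good case is n1011's `propagatedSelmerStructure_inr_eq_unramifiedSubgroup`.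
[cite: Rubin2011, §3.1 (p. 29)] [cite: SchaeferStoll2004, §3 Lemma 3.1 and Prop. 3.2]
[cite: MilneADT2006, Ch. I Prop. 3.8 and Remark 3.10] -/
theorem propagatedSelmerStructure_inr_eq_unramifiedSubgroup_of_not_dvd_localTamagawaNumber
    (hw : ((p : ℕ) : 𝓞 ℚ) ∉ w.asIdeal)
    (hc : ¬ p ∣ (W.baseChange (w.adicCompletion ℚ)).localTamagawaNumber (w.adicCompletionIntegers ℚ)) :
    propagatedSelmerStructure W p k (Sum.inr w) =
      unramifiedSubgroup (GaloisRep.toLocal w (W.torsionGaloisModule ((p : ℤ) ^ k * (p : ℤ)))) 1 := by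
  rw [propagatedSelmerStructure_inr_eq_kummerSelmerStructure W p k hw]
  have h := kummerSelmerStructure_inr_eq_unramifiedSubgroup_of_not_dvd_localTamagawaNumber W p hw hc (k + 1)
  have e : ((p ^ (k + 1) : ℕ) : ℤ) = (p : ℤ) ^ k * (p : ℤ) := by push_cast; ring
  rw [e] at h
  exact h

/-- **`𝓕_u(w) = 𝓕_can(w)` at a TAMAGAWA-FREE place** — the exponent-`0` case of the Kolyvagin-system
Tamagawa factor `[𝓕_can(w) : 𝓕_u(w)] = (c_w)_p` (Rubin Lemma 1.3.5; Büyükboduk 2009 §2.1.2 Remark 2 and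
hypothesis H.T of §3): at a finite `w ∤ p` with `p ∤ c_w = [E(ℚ_w) : E₀(ℚ_w)]` (`localTamagawaNumber`,
ANY reduction type: good, non-split multiplicative at odd `p`, split `I_n` with `p ∤ n`, additive with
`p ∤ c_w`), for every `k` and every choice `L` of conditions above `p`,
`blochKatoSelmerStructure p (tateTorsionDatum W p k) L (Sum.inr w) = propagatedSelmerStructure W p k (Sum.inr w)`:
`≤` is gen 2's `blochKatoSelmerStructure_inr_le_propagatedSelmerStructure`; `≥` is
`propagatedSelmerStructure_inr_eq_unramifiedSubgroup_of_not_dvd_localTamagawaNumber` with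
`unramifiedSubgroup_le_blochKatoSelmerStructure_inr_of_not_dvd_localTamagawaNumber`.
[cite: Rubin2000, Lemma 1.3.5] [cite: MazurRubin2004, Prop. 6.2.6 (p. 75) and App. A Remark A.5 (p. 81)]
[cite: MilneADT2006, Ch. I Prop. 3.8 and Remark 3.10] -/
theorem blochKatoSelmerStructure_inr_eq_propagatedSelmerStructure_of_not_dvd_localTamagawaNumber
    (L : (tateTorsionDatum W p k).LocalConditionsAbove p) (hw : ((p : ℕ) : 𝓞 ℚ) ∉ w.asIdeal)
    (hc : ¬ p ∣ (W.baseChange (w.adicCompletion ℚ)).localTamagawaNumber (w.adicCompletionIntegers ℚ)) :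
    blochKatoSelmerStructure p (tateTorsionDatum W p k) L (Sum.inr w) =
      propagatedSelmerStructure W p k (Sum.inr w) := by
  refine le_antisymm (blochKatoSelmerStructure_inr_le_propagatedSelmerStructure W p k w L hw) ?_
  rw [propagatedSelmerStructure_inr_eq_unramifiedSubgroup_of_not_dvd_localTamagawaNumber W p k w hw hc]
  exact unramifiedSubgroup_le_blochKatoSelmerStructure_inr_of_not_dvd_localTamagawaNumber W p k w L hw hc

/-- **`𝓕_u(w) = H¹_ur(ℚ_w, E[p^k · p])` at a Tamagawa-free `w ∤ p`**: the Bloch–Kato / unramified structure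
of the datum `π_{k+1} : T_pE → E[p^k · p]` at a finite `w ∤ p` with `p ∤ c_w` is the full unramified
subgroup of `H¹(ℚ_w, E[p^k · p])` (every `k`, every `L`).
[cite: Rubin2000, Lemma 1.3.5] [cite: MilneADT2006, Ch. I Prop. 3.8 and Remark 3.10] -/
theorem blochKatoSelmerStructure_inr_eq_unramifiedSubgroup_of_not_dvd_localTamagawaNumber
    (L : (tateTorsionDatum W p k).LocalConditionsAbove p) (hw : ((p : ℕ) : 𝓞 ℚ) ∉ w.asIdeal)
    (hc : ¬ p ∣ (W.baseChange (w.adicCompletion ℚ)).localTamagawaNumber (w.adicCompletionIntegers ℚ)) :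
    blochKatoSelmerStructure p (tateTorsionDatum W p k) L (Sum.inr w) =
      unramifiedSubgroup (GaloisRep.toLocal w (W.torsionGaloisModule ((p : ℤ) ^ k * (p : ℤ)))) 1 :=
  (blochKatoSelmerStructure_inr_eq_propagatedSelmerStructure_of_not_dvd_localTamagawaNumber W p k w L hw hc).trans
    (propagatedSelmerStructure_inr_eq_unramifiedSubgroup_of_not_dvd_localTamagawaNumber W p k w hw hc)

end Structures

/-! ### §2 Curves with no Tamagawa number divisible by `p` at the bad places `≠ p`: `𝓕_u = 𝓕_can` -/

section Global

variable (W : WeierstrassCurve ℚ) [W.IsElliptic] (p : ℕ) [hp : Fact p.Prime] (k : ℕ)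

/-- **`𝓕_u = 𝓕_can` at EVERY finite place when `p ∤ c_ℓ` for every bad `ℓ ≠ p`** (Büyükboduk's
hypothesis H.T; the «`3 ∤ ∏ c_ℓ`» rows of the W2 off-stratum items 19562 / 19599 at `p = 3`): for such a
curve, [MR04]'s unramified structure `blochKatoSelmerStructure p (tateTorsionDatum W p k) ⊤` (relaxed above
`p`) and Mazur–Rubin's propagated canonical structure `propagatedSelmerStructure W p k` coincide at every
finite place `w` and every depth `k` — so a Kolyvagin system for one is a Kolyvagin system for the other and
[MR04] Remark A.5 (gen 2's `exists_isKolyvaginSystem_pair_blochKatoSelmerStructure_of_unramified_odd`)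
costs nothing there: the Tamagawa defect of an Euler system of `T_pE` lives only at the places with
`p ∣ c_w`.  At `w ∣ p`: gen 2's `blochKatoSelmerStructure_relaxed_inr_eq_propagatedSelmerStructure`; at a
good `w ∤ p`: `c_w = 1` (`not_dvd_localTamagawaNumber_of_hasGoodReductionAt`); at a bad `w ∤ p`: §2 with
the hypothesis.
[cite: MazurRubin2004, Prop. 6.2.6 (p. 75) and App. A Remark A.5 (p. 81)] [cite: Rubin2000, Lemma 1.3.5] -/
theorem blochKatoSelmerStructure_relaxed_inr_eq_propagatedSelmerStructure_of_forall_not_dvd_localTamagawaNumber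
    (htam : ∀ w : HeightOneSpectrum (𝓞 ℚ), ((p : ℕ) : 𝓞 ℚ) ∉ w.asIdeal → ¬ W.HasGoodReductionAt w →
      ¬ p ∣ (W.baseChange (w.adicCompletion ℚ)).localTamagawaNumber (w.adicCompletionIntegers ℚ))
    (w : HeightOneSpectrum (𝓞 ℚ)) :
    blochKatoSelmerStructure p (tateTorsionDatum W p k) (fun _ _ => ⊤) (Sum.inr w) =
      propagatedSelmerStructure W p k (Sum.inr w) := by
  by_cases hw : ((p : ℕ) : 𝓞 ℚ) ∈ w.asIdeal
  · exact blochKatoSelmerStructure_relaxed_inr_eq_propagatedSelmerStructure W p k w hw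
  · by_cases hgood : W.HasGoodReductionAt w
    · exact blochKatoSelmerStructure_inr_eq_propagatedSelmerStructure_of_not_dvd_localTamagawaNumber W p k w _
        hw (not_dvd_localTamagawaNumber_of_hasGoodReductionAt W p hgood)
    · exact blochKatoSelmerStructure_inr_eq_propagatedSelmerStructure_of_not_dvd_localTamagawaNumber W p k w _
        hw (htam w hw hgood)

/-- The same for an ARBITRARY choice `L` of conditions above `p`, at the finite places AWAY from `p`:
if `p ∤ c_ℓ` for every bad `ℓ ≠ p`, then `𝓕_u(w) = 𝓕_can(w)` at every finite `w ∤ p`.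
[cite: MazurRubin2004, App. A Remark A.5 (p. 81)] [cite: Rubin2000, Lemma 1.3.5] -/
theorem blochKatoSelmerStructure_inr_eq_propagatedSelmerStructure_of_forall_not_dvd_localTamagawaNumber
    (L : (tateTorsionDatum W p k).LocalConditionsAbove p)
    (htam : ∀ w : HeightOneSpectrum (𝓞 ℚ), ((p : ℕ) : 𝓞 ℚ) ∉ w.asIdeal → ¬ W.HasGoodReductionAt w →
      ¬ p ∣ (W.baseChange (w.adicCompletion ℚ)).localTamagawaNumber (w.adicCompletionIntegers ℚ))
    (w : HeightOneSpectrum (𝓞 ℚ)) (hw : ((p : ℕ) : 𝓞 ℚ) ∉ w.asIdeal) :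
    blochKatoSelmerStructure p (tateTorsionDatum W p k) L (Sum.inr w) =
      propagatedSelmerStructure W p k (Sum.inr w) := by
  by_cases hgood : W.HasGoodReductionAt w
  · exact blochKatoSelmerStructure_inr_eq_propagatedSelmerStructure_of_not_dvd_localTamagawaNumber W p k w L
      hw (not_dvd_localTamagawaNumber_of_hasGoodReductionAt W p hgood)
  · exact blochKatoSelmerStructure_inr_eq_propagatedSelmerStructure_of_not_dvd_localTamagawaNumber W p k w L
      hw (htam w hw hgood)

end Global

/-! ### §3 Odd `p`: `𝓕_u = 𝓕_can` as Selmer structures, hence equal Selmer groups and equal `KS` -/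

section Odd

variable (W : WeierstrassCurve ℚ) [W.IsElliptic] (p : ℕ) [hp : Fact p.Prime] (k : ℕ)

/-- At an ARCHIMEDEAN place both structures have the same members when `p` is odd: the local group
`H¹(ℝ, E[p^k · p])` is `0` (`Γ_ℝ` has order `≤ 2`, `p^{k+1}` is odd; n1011
`Derivative.Rat.localization_inl_eq_zero_of_odd`). [cite: MilneADT2006, Ch. I Rem. 3.7] -/
theorem blochKatoSelmerStructure_inl_eq_propagatedSelmerStructure_of_odd (hp2 : p ≠ 2)
    (L : (tateTorsionDatum W p k).LocalConditionsAbove p) (v : InfinitePlace ℚ) :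
    blochKatoSelmerStructure p (tateTorsionDatum W p k) L (Sum.inl v) =
      propagatedSelmerStructure W p k (Sum.inl v) := by
  have hm : ((p : ℤ) ^ k * (p : ℤ)) = ((p ^ (k + 1) : ℕ) : ℤ) := by push_cast; ring
  ext x
  have hx : x = 0 := Derivative.Rat.localization_inl_eq_zero_of_odd W p hp2 hm v x
  rw [hx]
  exact ⟨fun _ => zero_mem _, fun _ => zero_mem _⟩

/-- **`𝓕_u = 𝓕_can` as Selmer structures on `E[p^k · p]`, `p` odd, `p ∤ c_ℓ` at every bad `ℓ ≠ p`**: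
[MR04]'s unramified structure `blochKatoSelmerStructure p (tateTorsionDatum W p k) ⊤` (relaxed above `p`)
IS Mazur–Rubin's propagated canonical structure `propagatedSelmerStructure W p k` — at every place
(finite: `…_relaxed_inr_eq_…_of_forall_not_dvd_localTamagawaNumber`; archimedean: the previous lemma).
[cite: MazurRubin2004, Prop. 6.2.6 (p. 75) and App. A Remark A.5 (p. 81)] [cite: Rubin2000, Lemma 1.3.5] -/
theorem blochKatoSelmerStructure_relaxed_eq_propagatedSelmerStructure_of_odd_of_forall_not_dvd_localTamagawaNumber
    (hp2 : p ≠ 2)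
    (htam : ∀ w : HeightOneSpectrum (𝓞 ℚ), ((p : ℕ) : 𝓞 ℚ) ∉ w.asIdeal → ¬ W.HasGoodReductionAt w →
      ¬ p ∣ (W.baseChange (w.adicCompletion ℚ)).localTamagawaNumber (w.adicCompletionIntegers ℚ)) :
    blochKatoSelmerStructure p (tateTorsionDatum W p k) (fun _ _ => ⊤) = propagatedSelmerStructure W p k := by
  funext v
  cases v with
  | inl v => exact blochKatoSelmerStructure_inl_eq_propagatedSelmerStructure_of_odd W p k hp2 _ v
  | inr w =>
    exact blochKatoSelmerStructure_relaxed_inr_eq_propagatedSelmerStructure_of_forall_not_dvd_localTamagawaNumber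
      W p k htam w

/-- **Equal Selmer groups**: for odd `p` and `p ∤ c_ℓ` at every bad `ℓ ≠ p`,
`H¹_{𝓕_u}(ℚ, E[p^k · p]) = H¹_{𝓕_can}(ℚ, E[p^k · p])`.
[cite: MazurRubin2004, Prop. 6.2.6 (p. 75) and App. A Remark A.5 (p. 81)] -/
theorem selmerGroup_blochKatoSelmerStructure_eq_of_odd_of_forall_not_dvd_localTamagawaNumber (hp2 : p ≠ 2)
    (htam : ∀ w : HeightOneSpectrum (𝓞 ℚ), ((p : ℕ) : 𝓞 ℚ) ∉ w.asIdeal → ¬ W.HasGoodReductionAt w →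
      ¬ p ∣ (W.baseChange (w.adicCompletion ℚ)).localTamagawaNumber (w.adicCompletionIntegers ℚ)) :
    (blochKatoSelmerStructure p (tateTorsionDatum W p k) (fun _ _ => ⊤)).selmerGroup =
      (propagatedSelmerStructure W p k).selmerGroup := by
  rw [blochKatoSelmerStructure_relaxed_eq_propagatedSelmerStructure_of_odd_of_forall_not_dvd_localTamagawaNumber
    W p k hp2 htam]
  rfl

/-- **Equal modules of Kolyvagin systems** (`KS₁(E[p^k · p], 𝓕_u, 𝒫) = KS₁(E[p^k · p], 𝓕_can, 𝒫)` for
every Kolyvagin datum), `p` odd, `p ∤ c_ℓ` at every bad `ℓ ≠ p`: in Büyükboduk's hypothesis H.T the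
factorisation `ES(T) → KS(T, 𝓕_u) → KS(T, 𝓕_can)` of [MR04] Remark A.5 has NO Tamagawa defect.
[cite: MazurRubin2004, Prop. 6.2.6 (p. 75) and App. A Remark A.5 (p. 81)] -/
theorem kolyvaginSystems_blochKatoSelmerStructure_eq_of_odd_of_forall_not_dvd_localTamagawaNumber (hp2 : p ≠ 2)
    (htam : ∀ w : HeightOneSpectrum (𝓞 ℚ), ((p : ℕ) : 𝓞 ℚ) ∉ w.asIdeal → ¬ W.HasGoodReductionAt w →
      ¬ p ∣ (W.baseChange (w.adicCompletion ℚ)).localTamagawaNumber (w.adicCompletionIntegers ℚ))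
    (D : KolyvaginDatum (W.torsionGaloisModule ((p : ℤ) ^ k * (p : ℤ)))) :
    D.kolyvaginSystems (blochKatoSelmerStructure p (tateTorsionDatum W p k) (fun _ _ => ⊤)) =
      D.kolyvaginSystems (propagatedSelmerStructure W p k) := by
  rw [blochKatoSelmerStructure_relaxed_eq_propagatedSelmerStructure_of_odd_of_forall_not_dvd_localTamagawaNumber
    W p k hp2 htam]

end Odd

end Summit.BirchSwinnertonDyer.BirchSwinnertonDyer.Theorems.KimAtThreeD7uTamagawaFreeStructures

end
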